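import Summits.CriticalPhenomena.PercolationContinuityZ3.Theorems.PercNearOneGluingNoHeavyQuantFarTreeRowContraction
import Summits.CriticalPhenomena.PercolationContinuityZ3.Theorems.PercNearOneGluingNoHeavyQuantFarTreeChainStep
import Literature.Probability.LatticeModels.ProdBernoulliClusterLocality
import HarnessLib

/-!
# QUANT lane R8 — block invariance and the series split of a gate (tools for moving relays along a comb)

builds on p205010 (kernel theorem, internal audit signed; external expert review pending)

Support file (`--supports stmt-CriticalPhenomena-4575`), QUANT lane lead (gen 9), rung R8 of `run/shared/lean/prim/quant/LADDER.md`;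
memo `prim-quant-lead-g9/LEAD-NOTES-G9.md` N20 step (4) — third file of the kernel proof of FAR (`Quant.FarTreeRow`) at EVERY layer on
COMBS.  Gate coordinates `prodBernoulli q` on `Set ι` (`ι` finite).  Theorems only; no sorries; standard axioms.

* `Quant.prodBernoulli_real_eq_of_block` — **block invariance**: if an event `B` sees the gates of a block `G` only through "all of `G` is
  open" (precisely: off `{G ⊆ ω}`, `ω ∈ B ↔ ω ∖ G ∈ B`), then its probability depends on the gate law on `G` only through `∏_{G} q`:
  `P_{q'}(B) = P_q(B)` whenever `q' = q` off `G` and `∏_G q' = ∏_G q`.  (Split `B` along `{G ⊆ ω}`; both pieces factor.)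
* `Quant.prodBernoulli_real_seriesSplit` — **series split**: replacing a gate `s` by the conjunction of `s` and a spare gate `u`
  (`q' s · q' u = q s`, `q' = q` off `{s, u}`) does not change the probability of any event `B` that ignores `u`, read through
  `B' = {ω | (u ∈ ω ? ω : ω ∖ {s}) ∈ B}`:  `P_{q'}(B') = P_q(B)`.  This is what lets a hair be spliced INTO the spine of a comb as a new level.
* `Quant.card_filter_subset_sdiff_of_block`, `Quant.subset_sdiff_iff_of_block` — the all-or-nothing bookkeeping: if every witness set
  contains the block or misses it, reach counts are unchanged by closing the block on configurations where the block is not fully open.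
[cite: Grimmett1999, §2.4 (conditioning on the state of one edge), §2.2 (disjointly supported events are independent)]; the series split is this work.
-/

noncomputable section

namespace Summit.CriticalPhenomena.PercolationContinuityZ3.Theorems

namespace Quant

open Finset MeasureTheory
open Literature.Probability.LatticeModels
open Literature.Probability.Percolation
open scoped Classical

variable {ι κ : Type*} [Fintype ι]

/-! ### Block invariance -/

/-- `ω ↦ ω ∪ G ∈ B` is determined by the coordinates off `G`. [folklore] -/
theorem determinedBy_union_mem (B : Set (Set ι)) (G : Finset ι) :
    DeterminedBy {ω : Set ι | ω ∪ ↑G ∈ B} (↑(univ \ G) : Set ι) := by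
  rw [determinedBy_iff]
  intro ω ω' h
  have key : ω ∪ ↑G = ω' ∪ ↑G := by
    ext i
    by_cases hi : i ∈ G
    · simp [hi]
    · have hiK : i ∈ (↑(univ \ G) : Set ι) := by simp [hi]
      have h1 : i ∈ ω ∩ ↑(univ \ G) ↔ i ∈ ω' ∩ ↑(univ \ G) := by rw [h]
      simp only [Set.mem_inter_iff, hiK, and_true] at h1
      simp [hi, h1]
  simp only [Set.mem_setOf_eq, key]

/-- `ω ↦ ω ∖ G ∈ B` is determined by the coordinates off `G`. [folklore] -/
theorem determinedBy_sdiff_mem (B : Set (Set ι)) (G : Finset ι) :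
    DeterminedBy {ω : Set ι | ω \ ↑G ∈ B} (↑(univ \ G) : Set ι) := by
  rw [determinedBy_iff]
  intro ω ω' h
  have key : ω \ ↑G = ω' \ ↑G := by
    ext i
    by_cases hi : i ∈ G
    · simp [hi]
    · have hiK : i ∈ (↑(univ \ G) : Set ι) := by simp [hi]
      have h1 : i ∈ ω ∩ ↑(univ \ G) ↔ i ∈ ω' ∩ ↑(univ \ G) := by rw [h]
      simp only [Set.mem_inter_iff, hiK, and_true] at h1
      simp [hi, h1]
  simp only [Set.mem_setOf_eq, key]

/-- Splitting an event along "the block `G` is fully open": if off `{G ⊆ ω}` membership in `B` is unchanged by closing `G`, then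
`P_q(B) = (∏_G q)·P_q(ω ∪ G ∈ B) + (1 − ∏_G q)·P_q(ω ∖ G ∈ B)`. [folklore] -/
theorem prodBernoulli_real_block_split (q : ι → unitInterval) (G : Finset ι) (B : Set (Set ι))
    (hB : ∀ ω : Set ι, ¬ ((↑G : Set ι) ⊆ ω) → (ω ∈ B ↔ ω \ ↑G ∈ B)) :
    (prodBernoulli q).real B =
      (∏ i ∈ G, (q i : ℝ)) * (prodBernoulli q).real {ω : Set ι | ω ∪ ↑G ∈ B} +
        (1 - ∏ i ∈ G, (q i : ℝ)) * (prodBernoulli q).real {ω : Set ι | ω \ ↑G ∈ B} := by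
  set μ := prodBernoulli q with hμ
  have hmeas : ∀ T : Set (Set ι), MeasurableSet T := fun T => (Set.toFinite T).measurableSet
  set O : Set (Set ι) := {ω | (↑G : Set ι) ⊆ ω} with hO
  set B₁ : Set (Set ι) := {ω | ω ∪ ↑G ∈ B} with hB₁
  set B₀ : Set (Set ι) := {ω | ω \ ↑G ∈ B} with hB₀
  have h1 : B ∩ O = B₁ ∩ O := by
    ext ω
    simp only [Set.mem_inter_iff, Set.mem_setOf_eq, hB₁, hO]
    constructor
    · rintro ⟨hb, ho⟩; exact ⟨by rwa [Set.union_eq_self_of_subset_right ho], ho⟩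
    · rintro ⟨hb, ho⟩; exact ⟨by rwa [Set.union_eq_self_of_subset_right ho] at hb, ho⟩
  have h0 : B \ O = B₀ \ O := by
    ext ω
    simp only [Set.mem_sdiff, Set.mem_setOf_eq, hB₀, hO]
    constructor
    · rintro ⟨hb, ho⟩; exact ⟨(hB ω ho).1 hb, ho⟩
    · rintro ⟨hb, ho⟩; exact ⟨(hB ω ho).2 hb, ho⟩
  have hdisj : Disjoint (univ \ G) G := Finset.sdiff_disjoint
  have dO : DeterminedBy O (↑G : Set ι) := determinedBy_subset_open G
  have p1 : μ.real (B₁ ∩ O) = μ.real B₁ * μ.real O :=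
    prodBernoulli_real_inter_of_determinedBy_disjoint q hdisj (determinedBy_union_mem B G) dO (hmeas _) (hmeas _)
  have p0 : μ.real (B₀ ∩ O) = μ.real B₀ * μ.real O :=
    prodBernoulli_real_inter_of_determinedBy_disjoint q hdisj (determinedBy_sdiff_mem B G) dO (hmeas _) (hmeas _)
  have hPO : μ.real O = ∏ i ∈ G, (q i : ℝ) := prodBernoulli_real_subset q G
  have hsplit : μ.real B = μ.real (B ∩ O) + μ.real (B \ O) := (measureReal_inter_add_sdiff (hmeas O)).symm
  have hsplit0 : μ.real (B₀ ∩ O) + μ.real (B₀ \ O) = μ.real B₀ := measureReal_inter_add_sdiff (hmeas O)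
  rw [hsplit, h1, h0, p1, hPO]
  rw [hPO] at p0
  linarith

/-- **Block invariance.**  If off `{G ⊆ ω}` membership in `B` is unchanged by closing `G` (every witness contains all of `G` or none
of it), then `P_{q'}(B) = P_q(B)` for any two gate laws that agree off `G` and have the same product over `G`. [this work] -/
theorem prodBernoulli_real_eq_of_block (q q' : ι → unitInterval) (G : Finset ι) (B : Set (Set ι))
    (hB : ∀ ω : Set ι, ¬ ((↑G : Set ι) ⊆ ω) → (ω ∈ B ↔ ω \ ↑G ∈ B))
    (hoff : ∀ i ∉ G, q' i = q i) (hprod : ∏ i ∈ G, (q' i : ℝ) = ∏ i ∈ G, (q i : ℝ)) :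
    (prodBernoulli q').real B = (prodBernoulli q).real B := by
  have hmeas : ∀ T : Set (Set ι), MeasurableSet T := fun T => (Set.toFinite T).measurableSet
  rw [prodBernoulli_real_block_split q' G B hB, prodBernoulli_real_block_split q G B hB, hprod]
  have hoff' : ∀ i ∈ (↑(univ \ G) : Set ι), q' i = q i := fun i hi => by
    simp only [Finset.coe_sdiff, Finset.coe_univ, Set.mem_sdiff, Set.mem_univ, true_and, Finset.mem_coe] at hi
    exact hoff i hi
  rw [prodBernoulli_real_eq_of_determinedBy q' q hoff' (determinedBy_union_mem B G) (hmeas _),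
    prodBernoulli_real_eq_of_determinedBy q' q hoff' (determinedBy_sdiff_mem B G) (hmeas _)]

/-! ### The series split of one gate -/

/-- **Series split.**  Let `s ≠ u` be gates, `q' = q` off `{s, u}` and `q' s · q' u = q s`.  For every event `B` that ignores the
coordinate `u`, the event `B' = {ω | (if u ∈ ω then ω else ω ∖ {s}) ∈ B}` ("`s` counts as open only if `u` is open too") has
`P_{q'}(B') = P_q(B)`: a gate may be replaced by two gates in series with the same product. [this work] -/
theorem prodBernoulli_real_seriesSplit (q q' : ι → unitInterval) {s u : ι} (hsu : s ≠ u) (B : Set (Set ι))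
    (hBu : DeterminedBy B (↑(univ.erase u) : Set ι))
    (hoff : ∀ i, i ≠ s → i ≠ u → q' i = q i) (hprod : (q' s : ℝ) * q' u = q s) :
    (prodBernoulli q').real {ω : Set ι | (if u ∈ ω then ω else ω \ {s}) ∈ B} = (prodBernoulli q).real B := by
  have hmeas : ∀ T : Set (Set ι), MeasurableSet T := fun T => (Set.toFinite T).measurableSet
  set B' : Set (Set ι) := {ω | (if u ∈ ω then ω else ω \ {s}) ∈ B} with hB'
  -- `B` ignores `u`: membership is unchanged by inserting or deleting `u`
  have hBu' : ∀ ω : Set ι, (ω ∈ B ↔ insert u ω ∈ B) ∧ (ω ∈ B ↔ ω \ {u} ∈ B) := by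
    intro ω
    rw [determinedBy_iff] at hBu
    refine ⟨hBu ω (insert u ω) ?_, hBu ω (ω \ {u}) ?_⟩
    · ext i; by_cases hi : i = u <;> simp [hi]
    · ext i; by_cases hi : i = u <;> simp [hi]
  -- step 1: block invariance on `G = {s, u}` takes `q'` to `q'' = q'[u ↦ 1][s ↦ q s]`
  set G : Finset ι := {s, u} with hG
  set q'' : ι → unitInterval := Function.update (Function.update q' u 1) s (q s) with hq''
  have hq''s : q'' s = q s := by simp [hq'']
  have hq''u : q'' u = 1 := by simp [hq'', Function.update_of_ne (Ne.symm hsu)]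
  have hq''off : ∀ i, i ≠ s → i ≠ u → q'' i = q i := fun i hs hu => by
    simp [hq'', Function.update_of_ne hs, Function.update_of_ne hu, hoff i hs hu]
  have hblock : ∀ ω : Set ι, ¬ ((↑G : Set ι) ⊆ ω) → (ω ∈ B' ↔ ω \ ↑G ∈ B') := by
    intro ω hω
    have hGc : (↑G : Set ι) = {s, u} := by simp [hG]
    simp only [hB', Set.mem_setOf_eq]
    have hus : u ∉ ω \ (↑G : Set ι) := fun h => h.2 (by simp [hG])
    rw [if_neg hus]
    by_cases hu : u ∈ ω
    · have hs : s ∉ ω := fun hs' => hω (by rw [hGc]; intro i hi; rcases hi with rfl | rfl <;> assumption)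
      rw [if_pos hu]
      have e1 : (ω \ ↑G) \ {s} = ω \ {u} := by
        rw [hGc]; ext i; by_cases h1 : i = s <;> by_cases h2 : i = u <;> simp [h1, h2, hs]
      rw [e1]; exact (hBu' ω).2
    · rw [if_neg hu]
      have e1 : (ω \ ↑G) \ {s} = ω \ {s} := by
        rw [hGc]; ext i; by_cases h1 : i = s <;> by_cases h2 : i = u <;> simp [h1, h2, hu]
      rw [e1]
  have hoffG : ∀ i ∉ G, q'' i = q' i := fun i hi => by
    have hs : i ≠ s := fun h => hi (by simp [hG, h])
    have hu : i ≠ u := fun h => hi (by simp [hG, h])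
    rw [hq''off i hs hu, hoff i hs hu]
  have hprodG : ∏ i ∈ G, (q'' i : ℝ) = ∏ i ∈ G, (q' i : ℝ) := by
    rw [hG, Finset.prod_pair hsu, Finset.prod_pair hsu, hq''s, hq''u, ← hprod]
    simp
  have step1 : (prodBernoulli q').real B' = (prodBernoulli q'').real B' :=
    (prodBernoulli_real_eq_of_block q' q'' G B' hblock hoffG hprodG).symm
  -- step 2: under `q''` the gate `u` is open a.s., so `B'` reads as `B`
  have hdet : DeterminedBy B' (↑(Finset.univ : Finset ι) : Set ι) := by
    rw [determinedBy_iff]; intro ω ω' h; simp only [Finset.coe_univ, Set.inter_univ] at h; rw [h]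
  have step2 : (prodBernoulli q'').real B' = (prodBernoulli q'').real {ω : Set ι | insert u ω ∈ B'} := by
    have h := prodBernoulli_real_update_one_eq hdet q'' (Finset.mem_univ u)
    rwa [show Function.update q'' u 1 = q'' from by
      ext i; by_cases hi : i = u
      · subst hi; simp [hq''u]
      · rw [Function.update_of_ne hi]] at h
  have hins : {ω : Set ι | insert u ω ∈ B'} = B := by
    ext ω
    simp only [hB', Set.mem_setOf_eq, Set.mem_insert_iff, true_or, ↓reduceIte]
    exact (hBu' ω).1.symm
  -- step 3: `B` ignores `u`, and `q'' = q` off `u`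
  have hoffu : ∀ i ∈ (↑(univ.erase u) : Set ι), q'' i = q i := fun i hi => by
    have hu : i ≠ u := by simpa using hi
    by_cases hs : i = s
    · subst hs; exact hq''s
    · exact hq''off i hs hu
  rw [step1, step2, hins, prodBernoulli_real_eq_of_determinedBy q'' q hoffu hBu (hmeas _)]

/-! ### All-or-nothing witnesses -/

omit [Fintype ι] in
/-- If a witness set contains the block `G` or misses it, then on a configuration where `G` is not fully open the witness is open
after closing `G` iff it was open. [folklore] -/
theorem subset_sdiff_iff_of_block {G F : Finset ι} (h : G ⊆ F ∨ Disjoint G F) {ω : Set ι} (hω : ¬ ((↑G : Set ι) ⊆ ω)) :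
    ((↑F : Set ι) ⊆ ω \ ↑G) ↔ (↑F : Set ι) ⊆ ω := by
  rcases h with h | h
  · -- `G ⊆ F`: both sides are false (unless `G = ∅`, excluded by `hω`)
    have hne : G.Nonempty := by
      rw [Finset.nonempty_iff_ne_empty]; rintro rfl; exact hω (by simp)
    obtain ⟨g, hg⟩ := hne
    constructor
    · intro hF; exact absurd (hF (Finset.mem_coe.2 (h hg))).2 (fun hn => hn (Finset.mem_coe.2 hg))
    · intro hF; exact absurd (subset_trans (Finset.coe_subset.2 h) hF) hω
  · constructor
    · intro hF i hi; exact (hF hi).1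
    · intro hF i hi
      exact ⟨hF hi, fun hG => Finset.disjoint_left.1 h (Finset.mem_coe.1 hG) (Finset.mem_coe.1 hi)⟩

omit [Fintype ι] in
/-- Reach counts over all-or-nothing witnesses are unchanged by closing the block off `{G ⊆ ω}`. [folklore] -/
theorem card_filter_subset_sdiff_of_block (S : Finset κ) (F : κ → Finset ι) (G : Finset ι)
    (h : ∀ z ∈ S, G ⊆ F z ∨ Disjoint G (F z)) {ω : Set ι} (hω : ¬ ((↑G : Set ι) ⊆ ω)) :
    (S.filter fun z => ((F z : Finset ι) : Set ι) ⊆ ω \ ↑G).card = (S.filter fun z => ((F z : Finset ι) : Set ι) ⊆ ω).card := by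
  congr 1
  exact Finset.filter_congr fun z hz => subset_sdiff_iff_of_block (h z hz) hω

end Quant

end Summit.CriticalPhenomena.PercolationContinuityZ3.Theorems

end
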